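import Mathlib
import Summits.PneNP.PneNP.Theorems.CnfIdealGenLengthRankDefectRepresentationsBandCompletionStep

/-!
# Crux `RankDefectRepresentations` (stmt-PneNP-18923), line `rank-dehn-ladder`: BAND COMPLETION at a double cut
# (registered stub `stub_bandCompletion`, RESHAPE 16, brief `Lines/rank-dehn-ladder-briefs-g16e.md` §X1)

Rows `x : ι` carry two colours `rI x : X`, `rJ x : Y`, columns `y : ι'` carry `cI y : X`, `cJ y : Y`; a cell is VISIBLE iff
`rI x ≠ cI y ∧ rJ x ≠ cJ y`.  For a double cut `(A, A′)` the ROW BAND is `U = {x | rI x ∈ A ∧ rJ x ∈ A′}` and the RECTANGLE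
`R(A,A′)` is `D` restricted to `U × {y | cI y ∉ A ∧ cJ y ∉ A′}` (all its cells are visible).  `stub_bandCompletion`: there is a
matrix `L` supported on the rows `U`, equal to `D` at every visible cell of those rows, with
`rank L ≤ rank R(A,A′) + Σ_{i∈A} spI i + Σ_{j∈A′} spJ j + Σ_{i,j} cp i j`, where each error term is a PRIVATE DIMENSION
`rank [reference | new column group] − rank [reference]` on the rows from which the new group is visible, for the rectangles at
the shifted cuts `(A∖i, A′)`, `(A, A′∖j)`, `(A∖i, A′∖j)`.
Construction: the generic COMPLETION STEP `…BandCompletionStep.completion_step` (column-space lift `exists_lift` of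
`…CutLemmaMaxCut`, p642504, restricted to the new columns) applied to the first-family strips `{cI = i, cJ ∉ A′}` and the
second-family strips `{cI ∉ A, cJ = j}` (reference = the rectangle) and then to the classes `{cI = i, cJ = j}` (reference =
rectangle + the two completed strips, which carries true data on the rows seeing the class); `L` = rectangle + all completed
groups; the rank bound is column-space bookkeeping (`LinearMap.range M.mulVecLin`, `finrank_biSup_le`).
HONEST FRAMING: negative-lane tool (with X2 `stub_bandAveraging` and the lead's assembly it gives `mc ≤ 4·E Φ`); the item
(RDR) stays open; P ≠ NP is not moved; F-N2 is a FRONTIER formal rung.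
-/

set_option linter.dupNamespace false -- `Summit.PneNP.PneNP.…`: summit = sub-problem name (D-0017)

namespace Summit.PneNP.PneNP.Theorems.CnfIdealGenLengthRankDefectRepresentationsBandCompletion

open Finset Matrix Module
open Summit.PneNP.PneNP.Theorems.CnfIdealGenLengthRankDefectRepresentationsBandCompletionStep
  (colSpan_mul_le colSpan_add_le colSpan_sum_le finrank_biSup_le completion_step)

section Main

/-- **BAND COMPLETION AT A DOUBLE CUT** (registered stub `stub_bandCompletion` of `Lines/rank_dehn_ladder.lean`, RESHAPE 16;
X1 of `Lines/rank-dehn-ladder-briefs-g16e.md`).  For every double cut `(A, A′)` there is a matrix `L` supported on the row band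
`{rI ∈ A, rJ ∈ A′}`, equal to `D` at every visible cell of the band, whose rank exceeds the rank of the rectangle `R(A,A′)` by
at most the sum of the private dimensions of the first-family strips, the second-family strips and the classes inside the
rectangles at the shifted cuts `(A∖i, A′)`, `(A, A′∖j)`, `(A∖i, A′∖j)`. -/
theorem stub_bandCompletion :
    ∀ (K : Type) [Field K] (ι ι' X Y : Type) [Fintype ι] [Fintype ι'] [DecidableEq ι] [DecidableEq ι'] [DecidableEq X] [DecidableEq Y]
      (rI : ι → X) (rJ : ι → Y) (cI : ι' → X) (cJ : ι' → Y) (D : Matrix ι ι' K) (A : Finset X) (A' : Finset Y),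
      ∃ L : Matrix ι ι' K,
        (∀ x y, ¬ (rI x ∈ A ∧ rJ x ∈ A') → L x y = 0) ∧
        (∀ x y, rI x ∈ A → rJ x ∈ A' → rI x ≠ cI y → rJ x ≠ cJ y → L x y = D x y) ∧
        (L.rank : ℤ) ≤
          ((Matrix.of fun x y => if (rI x ∈ A ∧ rJ x ∈ A') ∧ (cI y ∉ A ∧ cJ y ∉ A') then D x y else 0).rank : ℤ) +
          ∑ i ∈ A,
            (((Matrix.of fun x y => if (rI x ∈ A.erase i ∧ rJ x ∈ A') ∧ (cI y ∉ A.erase i ∧ cJ y ∉ A') then D x y else 0).rank : ℤ) -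
             ((Matrix.of fun x y => if (rI x ∈ A.erase i ∧ rJ x ∈ A') ∧ (cI y ∉ A ∧ cJ y ∉ A') then D x y else 0).rank : ℤ)) +
          ∑ j ∈ A',
            (((Matrix.of fun x y => if (rI x ∈ A ∧ rJ x ∈ A'.erase j) ∧ (cI y ∉ A ∧ cJ y ∉ A'.erase j) then D x y else 0).rank : ℤ) -
             ((Matrix.of fun x y => if (rI x ∈ A ∧ rJ x ∈ A'.erase j) ∧ (cI y ∉ A ∧ cJ y ∉ A') then D x y else 0).rank : ℤ)) +
          ∑ i ∈ A, ∑ j ∈ A',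
            (((Matrix.of fun x y => if (rI x ∈ A.erase i ∧ rJ x ∈ A'.erase j) ∧ (cI y ∉ A.erase i ∧ cJ y ∉ A'.erase j)
                then D x y else 0).rank : ℤ) -
             ((Matrix.of fun x y => if (rI x ∈ A.erase i ∧ rJ x ∈ A'.erase j) ∧ (cI y ∉ A.erase i ∧ cJ y ∉ A'.erase j) ∧
                  ¬ (cI y = i ∧ cJ y = j) then D x y else 0).rank : ℤ))  := by
  intro K _ ι ι' X Y _ _ _ _ _ _ rI rJ cI cJ D A A'
  -- the rectangle `R(A,A′)`: rows of the band, antipodal columns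
  set Qm : Matrix ι ι' K :=
    Matrix.of fun x y => if (rI x ∈ A ∧ rJ x ∈ A') ∧ (cI y ∉ A ∧ cJ y ∉ A') then D x y else 0 with hQm
  have Qm_apply : ∀ x y, Qm x y = if (rI x ∈ A ∧ rJ x ∈ A') ∧ (cI y ∉ A ∧ cJ y ∉ A') then D x y else 0 :=
    fun x y => by simp only [hQm, Matrix.of_apply]
  have colQm : ∀ x y, ¬ (cI y ∉ A ∧ cJ y ∉ A') → Qm x y = 0 :=
    fun x y hy => by rw [Qm_apply, if_neg (fun h => hy h.2)]
  have rowQm : ∀ x, ¬ (rI x ∈ A ∧ rJ x ∈ A') → ∀ y, Qm x y = 0 :=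
    fun x hx y => by rw [Qm_apply, if_neg (fun h => hx h.1)]
  have agQm : ∀ x y, (rI x ∈ A ∧ rJ x ∈ A') → (cI y ∉ A ∧ cJ y ∉ A') → Qm x y = D x y :=
    fun x y hx hy => by rw [Qm_apply, if_pos ⟨hx, hy⟩]
  -- a zero row stays zero under right multiplication
  have rowMul : ∀ (M : Matrix ι ι' K) (W : Matrix ι' ι' K) x, (∀ y, M x y = 0) → ∀ y, (M * W) x y = 0 := by
    intro M W x hx y
    simp only [Matrix.mul_apply]
    exact Finset.sum_eq_zero fun y' _ => by rw [hx y', zero_mul]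
  -- (1) first-family strips `{cI = i, cJ ∉ A′}` (visible from the rows `{rI ∈ A∖i, rJ ∈ A′}`), completed through the rectangle
  have hI := fun i (hi : i ∈ A) =>
    completion_step Qm D (fun x => rI x ∈ A.erase i ∧ rJ x ∈ A') (fun y => cI y ∉ A ∧ cJ y ∉ A')
      (fun y => cI y = i ∧ cJ y ∉ A')
      (fun y hs hv => hv.1 (by rw [hs.1]; exact hi))
      (fun x y hy => colQm x y hy)
      (fun x y hx hy => agQm x y ⟨Finset.mem_of_mem_erase hx.1, hx.2⟩ hy)
  choose! WI EI colIW colIE rowIE agI rkI using hI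
  -- (2) second-family strips `{cI ∉ A, cJ = j}` (visible from `{rI ∈ A, rJ ∈ A′∖j}`), completed through the rectangle
  have hJ := fun j (hj : j ∈ A') =>
    completion_step Qm D (fun x => rI x ∈ A ∧ rJ x ∈ A'.erase j) (fun y => cI y ∉ A ∧ cJ y ∉ A')
      (fun y => cI y ∉ A ∧ cJ y = j)
      (fun y hs hv => hv.2 (by rw [hs.2]; exact hj))
      (fun x y hy => colQm x y hy)
      (fun x y hx hy => agQm x y ⟨hx.1, Finset.mem_of_mem_erase hx.2⟩ hy)
  choose! WJ EJ colJW colJE rowJE agJ rkJ using hJ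
  -- the completed strips
  set LI : X → Matrix ι ι' K := fun i => Qm * WI i + EI i with hLI
  set LJ : Y → Matrix ι ι' K := fun j => Qm * WJ j + EJ j with hLJ
  have LIdef : ∀ i, LI i = Qm * WI i + EI i := fun i => by simp only [hLI]
  have LJdef : ∀ j, LJ j = Qm * WJ j + EJ j := fun j => by simp only [hLJ]
  have LI_apply : ∀ i x y, LI i x y = (Qm * WI i) x y + EI i x y := fun i x y => by
    rw [LIdef, Matrix.add_apply]
  have LJ_apply : ∀ j x y, LJ j x y = (Qm * WJ j) x y + EJ j x y := fun j x y => by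
    rw [LJdef, Matrix.add_apply]
  have colLI : ∀ i ∈ A, ∀ x y, ¬ (cI y = i ∧ cJ y ∉ A') → LI i x y = 0 := fun i hi x y hy => by
    rw [LI_apply, colIW i hi x y hy, colIE i hi x y hy, add_zero]
  have colLJ : ∀ j ∈ A', ∀ x y, ¬ (cI y ∉ A ∧ cJ y = j) → LJ j x y = 0 := fun j hj x y hy => by
    rw [LJ_apply, colJW j hj x y hy, colJE j hj x y hy, add_zero]
  have rowLI : ∀ i ∈ A, ∀ x, ¬ (rI x ∈ A ∧ rJ x ∈ A') → ∀ y, LI i x y = 0 := fun i hi x hx y => by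
    rw [LI_apply, rowMul Qm (WI i) x (rowQm x hx) y,
      rowIE i hi x y (fun h => hx ⟨Finset.mem_of_mem_erase h.1, h.2⟩), add_zero]
  have rowLJ : ∀ j ∈ A', ∀ x, ¬ (rI x ∈ A ∧ rJ x ∈ A') → ∀ y, LJ j x y = 0 := fun j hj x hx y => by
    rw [LJ_apply, rowMul Qm (WJ j) x (rowQm x hx) y,
      rowJE j hj x y (fun h => hx ⟨h.1, Finset.mem_of_mem_erase h.2⟩), add_zero]
  have agLI : ∀ i ∈ A, ∀ x y, (rI x ∈ A.erase i ∧ rJ x ∈ A') → (cI y = i ∧ cJ y ∉ A') → LI i x y = D x y :=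
    fun i hi x y hx hy => by rw [LI_apply]; exact agI i hi x y hx hy
  have agLJ : ∀ j ∈ A', ∀ x y, (rI x ∈ A ∧ rJ x ∈ A'.erase j) → (cI y ∉ A ∧ cJ y = j) → LJ j x y = D x y :=
    fun j hj x y hx hy => by rw [LJ_apply]; exact agJ j hj x y hx hy
  -- (3) classes `{cI = i, cJ = j}` (visible from `{rI ∈ A∖i, rJ ∈ A′∖j}`), completed through the REFERENCE
  -- `Qm + LI i + LJ j` = rectangle + both completed strips, which carries true data on those rows
  have refCol : ∀ i ∈ A, ∀ j ∈ A', ∀ x y,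
      ¬ ((cI y ∉ A.erase i ∧ cJ y ∉ A'.erase j) ∧ ¬ (cI y = i ∧ cJ y = j)) → (Qm + LI i + LJ j) x y = 0 := by
    intro i hi j hj x y hy
    have h1 : ¬ (cI y ∉ A ∧ cJ y ∉ A') := fun h =>
      hy ⟨⟨fun h' => h.1 (Finset.mem_of_mem_erase h'), fun h' => h.2 (Finset.mem_of_mem_erase h')⟩,
        fun h' => h.1 (h'.1 ▸ hi)⟩
    have h2 : ¬ (cI y = i ∧ cJ y ∉ A') := fun h =>
      hy ⟨⟨h.1 ▸ Finset.notMem_erase i A, fun h' => h.2 (Finset.mem_of_mem_erase h')⟩,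
        fun h' => h.2 (h'.2 ▸ hj)⟩
    have h3 : ¬ (cI y ∉ A ∧ cJ y = j) := fun h =>
      hy ⟨⟨fun h' => h.1 (Finset.mem_of_mem_erase h'), h.2 ▸ Finset.notMem_erase j A'⟩,
        fun h' => h.1 (h'.1 ▸ hi)⟩
    rw [Matrix.add_apply, Matrix.add_apply, colQm x y h1, colLI i hi x y h2, colLJ j hj x y h3, add_zero, add_zero]
  have refRow : ∀ i ∈ A, ∀ j ∈ A', ∀ x y, (rI x ∈ A.erase i ∧ rJ x ∈ A'.erase j) →
      ((cI y ∉ A.erase i ∧ cJ y ∉ A'.erase j) ∧ ¬ (cI y = i ∧ cJ y = j)) → (Qm + LI i + LJ j) x y = D x y := by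
    intro i hi j hj x y hx hy
    have hxA : rI x ∈ A := Finset.mem_of_mem_erase hx.1
    have hxA' : rJ x ∈ A' := Finset.mem_of_mem_erase hx.2
    rw [Matrix.add_apply, Matrix.add_apply]
    by_cases hci : cI y = i
    · -- a first-family strip column
      have hcj : cJ y ∉ A' := fun h' => hy.1.2 (Finset.mem_erase.mpr ⟨fun h'' => hy.2 ⟨hci, h''⟩, h'⟩)
      rw [colQm x y (fun h => h.1 (hci ▸ hi)), agLI i hi x y ⟨hx.1, hxA'⟩ ⟨hci, hcj⟩,
        colLJ j hj x y (fun h => h.1 (hci ▸ hi)), zero_add, add_zero]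
    · have hcA : cI y ∉ A := fun h' => hy.1.1 (Finset.mem_erase.mpr ⟨hci, h'⟩)
      by_cases hcj : cJ y = j
      · -- a second-family strip column
        rw [colQm x y (fun h => h.2 (hcj ▸ hj)), colLI i hi x y (fun h => hci h.1),
          agLJ j hj x y ⟨hxA, hx.2⟩ ⟨hcA, hcj⟩, zero_add, zero_add]
      · -- a rectangle column
        have hcA' : cJ y ∉ A' := fun h' => hy.1.2 (Finset.mem_erase.mpr ⟨hcj, h'⟩)
        rw [agQm x y ⟨hxA, hxA'⟩ ⟨hcA, hcA'⟩, colLI i hi x y (fun h => hci h.1),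
          colLJ j hj x y (fun h => hcj h.2), add_zero, add_zero]
  have hC := fun i (hi : i ∈ A) j (hj : j ∈ A') =>
    completion_step (Qm + LI i + LJ j) D (fun x => rI x ∈ A.erase i ∧ rJ x ∈ A'.erase j)
      (fun y => (cI y ∉ A.erase i ∧ cJ y ∉ A'.erase j) ∧ ¬ (cI y = i ∧ cJ y = j)) (fun y => cI y = i ∧ cJ y = j)
      (fun y hs hv => hv.2 hs)
      (refCol i hi j hj) (refRow i hi j hj)
  choose! WC EC colCW colCE rowCE agC rkC using hC
  -- the completed classes and the band matrix
  set LC : X → Y → Matrix ι ι' K := fun i j => (Qm + LI i + LJ j) * WC i j + EC i j with hLC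
  have LCdef : ∀ i j, LC i j = (Qm + LI i + LJ j) * WC i j + EC i j := fun i j => by simp only [hLC]
  have LC_apply : ∀ i j x y, LC i j x y = ((Qm + LI i + LJ j) * WC i j) x y + EC i j x y :=
    fun i j x y => by rw [LCdef, Matrix.add_apply]
  have colLC : ∀ i ∈ A, ∀ j ∈ A', ∀ x y, ¬ (cI y = i ∧ cJ y = j) → LC i j x y = 0 := fun i hi j hj x y hy => by
    rw [LC_apply, colCW i hi j hj x y hy, colCE i hi j hj x y hy, add_zero]
  have rowLC : ∀ i ∈ A, ∀ j ∈ A', ∀ x, ¬ (rI x ∈ A ∧ rJ x ∈ A') → ∀ y, LC i j x y = 0 := by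
    intro i hi j hj x hx y
    have hr : ∀ y, (Qm + LI i + LJ j) x y = 0 := fun y => by
      rw [Matrix.add_apply, Matrix.add_apply, rowQm x hx y, rowLI i hi x hx y, rowLJ j hj x hx y, add_zero, add_zero]
    rw [LC_apply, rowMul _ (WC i j) x hr y,
      rowCE i hi j hj x y (fun h => hx ⟨Finset.mem_of_mem_erase h.1, Finset.mem_of_mem_erase h.2⟩), add_zero]
  have agLC : ∀ i ∈ A, ∀ j ∈ A', ∀ x y, (rI x ∈ A.erase i ∧ rJ x ∈ A'.erase j) → (cI y = i ∧ cJ y = j) →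
      LC i j x y = D x y := fun i hi j hj x y hx hy => by rw [LC_apply]; exact agC i hi j hj x y hx hy
  set L : Matrix ι ι' K := Qm + ∑ i ∈ A, LI i + ∑ j ∈ A', LJ j + ∑ i ∈ A, ∑ j ∈ A', LC i j with hL
  have L_apply : ∀ x y, L x y = Qm x y + ∑ i ∈ A, LI i x y + ∑ j ∈ A', LJ j x y + ∑ i ∈ A, ∑ j ∈ A', LC i j x y := by
    intro x y; simp only [hL, Matrix.add_apply, Matrix.sum_apply]
  refine ⟨L, ?_, ?_, ?_⟩
  · -- support on the band rows
    intro x y hx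
    rw [L_apply, rowQm x hx y, Finset.sum_eq_zero fun i hi => rowLI i hi x hx y,
      Finset.sum_eq_zero fun j hj => rowLJ j hj x hx y,
      Finset.sum_eq_zero fun i hi => Finset.sum_eq_zero fun j hj => rowLC i hi j hj x hx y]
    ring
  · -- agreement at the visible cells of the band: exactly one summand carries the column of `y`
    intro x y hxA hxA' hvI hvJ
    rw [L_apply]
    by_cases hcA : cI y ∈ A
    · have e1 : Qm x y = 0 := colQm x y (fun h => h.1 hcA)
      have e3 : ∑ j ∈ A', LJ j x y = 0 := Finset.sum_eq_zero fun j hj => colLJ j hj x y (fun h => h.1 hcA)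
      by_cases hcA' : cJ y ∈ A'
      · -- class column `(cI y, cJ y)`
        have e2 : ∑ i ∈ A, LI i x y = 0 := Finset.sum_eq_zero fun i hi => colLI i hi x y (fun h => h.2 hcA')
        have e4 : ∑ i ∈ A, ∑ j ∈ A', LC i j x y = D x y := by
          rw [Finset.sum_eq_single_of_mem (cI y) hcA (fun i hi hne =>
              Finset.sum_eq_zero fun j hj => colLC i hi j hj x y (fun h => hne h.1.symm)),
            Finset.sum_eq_single_of_mem (cJ y) hcA' (fun j hj hne => colLC (cI y) hcA j hj x y (fun h => hne h.2.symm))]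
          exact agLC (cI y) hcA (cJ y) hcA' x y
            ⟨Finset.mem_erase.mpr ⟨hvI, hxA⟩, Finset.mem_erase.mpr ⟨hvJ, hxA'⟩⟩ ⟨rfl, rfl⟩
        rw [e1, e2, e3, e4]; ring
      · -- first-family strip column `cI y`
        have e2 : ∑ i ∈ A, LI i x y = D x y := by
          rw [Finset.sum_eq_single_of_mem (cI y) hcA (fun i hi hne => colLI i hi x y (fun h => hne h.1.symm))]
          exact agLI (cI y) hcA x y ⟨Finset.mem_erase.mpr ⟨hvI, hxA⟩, hxA'⟩ ⟨rfl, hcA'⟩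
        have e4 : ∑ i ∈ A, ∑ j ∈ A', LC i j x y = 0 := Finset.sum_eq_zero fun i hi =>
          Finset.sum_eq_zero fun j hj => colLC i hi j hj x y (fun h => hcA' (h.2 ▸ hj))
        rw [e1, e2, e3, e4]; ring
    · have e2 : ∑ i ∈ A, LI i x y = 0 := Finset.sum_eq_zero fun i hi => colLI i hi x y (fun h => hcA (h.1 ▸ hi))
      have e4 : ∑ i ∈ A, ∑ j ∈ A', LC i j x y = 0 := Finset.sum_eq_zero fun i hi =>
        Finset.sum_eq_zero fun j hj => colLC i hi j hj x y (fun h => hcA (h.1 ▸ hi))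
      by_cases hcA' : cJ y ∈ A'
      · -- second-family strip column `cJ y`
        have e1 : Qm x y = 0 := colQm x y (fun h => h.2 hcA')
        have e3 : ∑ j ∈ A', LJ j x y = D x y := by
          rw [Finset.sum_eq_single_of_mem (cJ y) hcA' (fun j hj hne => colLJ j hj x y (fun h => hne h.2.symm))]
          exact agLJ (cJ y) hcA' x y ⟨hxA, Finset.mem_erase.mpr ⟨hvJ, hxA'⟩⟩ ⟨hcA, rfl⟩
        rw [e1, e2, e3, e4]; ring
      · -- rectangle column
        have e1 : Qm x y = D x y := agQm x y ⟨hxA, hxA'⟩ ⟨hcA, hcA'⟩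
        have e3 : ∑ j ∈ A', LJ j x y = 0 := Finset.sum_eq_zero fun j hj => colLJ j hj x y (fun h => hcA' (h.2 ▸ hj))
        rw [e1, e2, e3, e4]; ring
  · -- rank: every column of `L` lies in `colspace Qm + Σ colspace (EI i) + Σ colspace (EJ j) + Σ colspace (EC i j)`
    set S : Submodule K (ι → K) := LinearMap.range Qm.mulVecLin ⊔ (⨆ i ∈ A, LinearMap.range (EI i).mulVecLin) ⊔
      (⨆ j ∈ A', LinearMap.range (EJ j).mulVecLin) ⊔ (⨆ i ∈ A, ⨆ j ∈ A', LinearMap.range (EC i j).mulVecLin) with hS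
    have hQmS : LinearMap.range Qm.mulVecLin ≤ S := by
      rw [hS]; exact le_sup_left.trans (le_sup_left.trans le_sup_left)
    have hEIS : ∀ i ∈ A, LinearMap.range (EI i).mulVecLin ≤ S := fun i hi => by
      have h : LinearMap.range (EI i).mulVecLin ≤ ⨆ i ∈ A, LinearMap.range (EI i).mulVecLin :=
        le_iSup₂_of_le (f := fun i (_ : i ∈ A) => LinearMap.range (EI i).mulVecLin) i hi le_rfl
      rw [hS]; exact h.trans (le_sup_right.trans (le_sup_left.trans le_sup_left))
    have hEJS : ∀ j ∈ A', LinearMap.range (EJ j).mulVecLin ≤ S := fun j hj => by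
      have h : LinearMap.range (EJ j).mulVecLin ≤ ⨆ j ∈ A', LinearMap.range (EJ j).mulVecLin :=
        le_iSup₂_of_le (f := fun j (_ : j ∈ A') => LinearMap.range (EJ j).mulVecLin) j hj le_rfl
      rw [hS]; exact h.trans (le_sup_right.trans le_sup_left)
    have hECS : ∀ i ∈ A, ∀ j ∈ A', LinearMap.range (EC i j).mulVecLin ≤ S := fun i hi j hj => by
      have h1 : LinearMap.range (EC i j).mulVecLin ≤ ⨆ j ∈ A', LinearMap.range (EC i j).mulVecLin :=
        le_iSup₂_of_le (f := fun j (_ : j ∈ A') => LinearMap.range (EC i j).mulVecLin) j hj le_rfl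
      have h2 : (⨆ j ∈ A', LinearMap.range (EC i j).mulVecLin) ≤
          ⨆ i ∈ A, ⨆ j ∈ A', LinearMap.range (EC i j).mulVecLin :=
        le_iSup₂_of_le (f := fun i (_ : i ∈ A) => ⨆ j ∈ A', LinearMap.range (EC i j).mulVecLin) i hi le_rfl
      rw [hS]; exact (h1.trans h2).trans le_sup_right
    have hLIS : ∀ i ∈ A, LinearMap.range (LI i).mulVecLin ≤ S := fun i hi => by
      rw [LIdef]; exact (colSpan_add_le _ _).trans (sup_le ((colSpan_mul_le _ _).trans hQmS) (hEIS i hi))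
    have hLJS : ∀ j ∈ A', LinearMap.range (LJ j).mulVecLin ≤ S := fun j hj => by
      rw [LJdef]; exact (colSpan_add_le _ _).trans (sup_le ((colSpan_mul_le _ _).trans hQmS) (hEJS j hj))
    have hRefS : ∀ i ∈ A, ∀ j ∈ A', LinearMap.range (Qm + LI i + LJ j).mulVecLin ≤ S := fun i hi j hj =>
      (colSpan_add_le _ _).trans (sup_le ((colSpan_add_le _ _).trans (sup_le hQmS (hLIS i hi))) (hLJS j hj))
    have hLCS : ∀ i ∈ A, ∀ j ∈ A', LinearMap.range (LC i j).mulVecLin ≤ S := fun i hi j hj => by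
      rw [LCdef]; exact (colSpan_add_le _ _).trans (sup_le ((colSpan_mul_le _ _).trans (hRefS i hi j hj)) (hECS i hi j hj))
    have hLS : LinearMap.range L.mulVecLin ≤ S := by
      rw [hL]
      refine (colSpan_add_le _ _).trans (sup_le ((colSpan_add_le _ _).trans (sup_le ((colSpan_add_le _ _).trans
        (sup_le hQmS ?_)) ?_)) ?_)
      · exact (colSpan_sum_le _ _).trans (iSup₂_le fun i hi => hLIS i hi)
      · exact (colSpan_sum_le _ _).trans (iSup₂_le fun j hj => hLJS j hj)
      · exact (colSpan_sum_le _ _).trans (iSup₂_le fun i hi =>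
          (colSpan_sum_le _ _).trans (iSup₂_le fun j hj => hLCS i hi j hj))
    have hfin : L.rank ≤ Qm.rank + ∑ i ∈ A, (EI i).rank + ∑ j ∈ A', (EJ j).rank +
        ∑ i ∈ A, ∑ j ∈ A', (EC i j).rank := by
      refine (Submodule.finrank_mono hLS).trans ?_
      rw [hS]
      refine (Submodule.finrank_add_le_finrank_add_finrank _ _).trans (Nat.add_le_add
        ((Submodule.finrank_add_le_finrank_add_finrank _ _).trans (Nat.add_le_add
          ((Submodule.finrank_add_le_finrank_add_finrank _ _).trans (Nat.add_le_add le_rfl (finrank_biSup_le _ _)))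
          (finrank_biSup_le _ _))) ?_)
      exact (finrank_biSup_le _ _).trans (Finset.sum_le_sum fun i _ => finrank_biSup_le _ _)
    -- identify the three lifted pairs with the rectangles at the shifted cuts
    have eI : ∀ i ∈ A,
        (Matrix.of fun x y => if (rI x ∈ A.erase i ∧ rJ x ∈ A') ∧ (cI y ∉ A ∧ cJ y ∉ A') then D x y else 0) +
          (Matrix.of fun x y => if (rI x ∈ A.erase i ∧ rJ x ∈ A') ∧ (cI y = i ∧ cJ y ∉ A') then D x y else 0) =
        Matrix.of fun x y => if (rI x ∈ A.erase i ∧ rJ x ∈ A') ∧ (cI y ∉ A.erase i ∧ cJ y ∉ A') then D x y else 0 := by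
      intro i hi; ext x y
      simp only [Matrix.add_apply, Matrix.of_apply]
      by_cases hx : rI x ∈ A.erase i ∧ rJ x ∈ A'
      · by_cases h2 : cJ y ∈ A'
        · rw [if_neg (fun h => h.2.2 h2), if_neg (fun h => h.2.2 h2), if_neg (fun h => h.2.2 h2), add_zero]
        · by_cases h1 : cI y = i
          · have hm : cI y ∉ A.erase i := h1 ▸ Finset.notMem_erase i A
            rw [if_neg (fun h => h.2.1 (h1 ▸ hi)), if_pos ⟨hx, h1, h2⟩, if_pos ⟨hx, hm, h2⟩, zero_add]
          · by_cases h3 : cI y ∈ A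
            · have hm : ¬ (cI y ∉ A.erase i) := fun h => h (Finset.mem_erase.mpr ⟨h1, h3⟩)
              rw [if_neg (fun h => h.2.1 h3), if_neg (fun h => h1 h.2.1), if_neg (fun h => hm h.2.1), add_zero]
            · have hm : cI y ∉ A.erase i := fun h => h3 (Finset.mem_of_mem_erase h)
              rw [if_pos ⟨hx, h3, h2⟩, if_neg (fun h => h1 h.2.1), if_pos ⟨hx, hm, h2⟩, add_zero]
      · rw [if_neg (fun h => hx h.1), if_neg (fun h => hx h.1), if_neg (fun h => hx h.1), add_zero]
    have eJ : ∀ j ∈ A',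
        (Matrix.of fun x y => if (rI x ∈ A ∧ rJ x ∈ A'.erase j) ∧ (cI y ∉ A ∧ cJ y ∉ A') then D x y else 0) +
          (Matrix.of fun x y => if (rI x ∈ A ∧ rJ x ∈ A'.erase j) ∧ (cI y ∉ A ∧ cJ y = j) then D x y else 0) =
        Matrix.of fun x y => if (rI x ∈ A ∧ rJ x ∈ A'.erase j) ∧ (cI y ∉ A ∧ cJ y ∉ A'.erase j) then D x y else 0 := by
      intro j hj; ext x y
      simp only [Matrix.add_apply, Matrix.of_apply]
      by_cases hx : rI x ∈ A ∧ rJ x ∈ A'.erase j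
      · by_cases h2 : cI y ∈ A
        · rw [if_neg (fun h => h.2.1 h2), if_neg (fun h => h.2.1 h2), if_neg (fun h => h.2.1 h2), add_zero]
        · by_cases h1 : cJ y = j
          · have hm : cJ y ∉ A'.erase j := h1 ▸ Finset.notMem_erase j A'
            rw [if_neg (fun h => h.2.2 (h1 ▸ hj)), if_pos ⟨hx, h2, h1⟩, if_pos ⟨hx, h2, hm⟩, zero_add]
          · by_cases h3 : cJ y ∈ A'
            · have hm : ¬ (cJ y ∉ A'.erase j) := fun h => h (Finset.mem_erase.mpr ⟨h1, h3⟩)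
              rw [if_neg (fun h => h.2.2 h3), if_neg (fun h => h1 h.2.2), if_neg (fun h => hm h.2.2), add_zero]
            · have hm : cJ y ∉ A'.erase j := fun h => h3 (Finset.mem_of_mem_erase h)
              rw [if_pos ⟨hx, h2, h3⟩, if_neg (fun h => h1 h.2.2), if_pos ⟨hx, h2, hm⟩, add_zero]
      · rw [if_neg (fun h => hx h.1), if_neg (fun h => hx h.1), if_neg (fun h => hx h.1), add_zero]
    have eC : ∀ (i : X) (j : Y),
        (Matrix.of fun x y => if (rI x ∈ A.erase i ∧ rJ x ∈ A'.erase j) ∧ (cI y ∉ A.erase i ∧ cJ y ∉ A'.erase j) ∧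
            ¬ (cI y = i ∧ cJ y = j) then D x y else 0) +
          (Matrix.of fun x y => if (rI x ∈ A.erase i ∧ rJ x ∈ A'.erase j) ∧ (cI y = i ∧ cJ y = j) then D x y else 0) =
        Matrix.of fun x y => if (rI x ∈ A.erase i ∧ rJ x ∈ A'.erase j) ∧ (cI y ∉ A.erase i ∧ cJ y ∉ A'.erase j)
          then D x y else 0 := by
      intro i j; ext x y
      simp only [Matrix.add_apply, Matrix.of_apply]
      by_cases hx : rI x ∈ A.erase i ∧ rJ x ∈ A'.erase j
      · by_cases hc : cI y = i ∧ cJ y = j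
        · have hm : cI y ∉ A.erase i ∧ cJ y ∉ A'.erase j :=
            ⟨hc.1 ▸ Finset.notMem_erase i A, hc.2 ▸ Finset.notMem_erase j A'⟩
          rw [if_neg (fun h => h.2.2 hc), if_pos ⟨hx, hc⟩, if_pos ⟨hx, hm⟩, zero_add]
        · by_cases hm : cI y ∉ A.erase i ∧ cJ y ∉ A'.erase j
          · rw [if_pos ⟨hx, hm, hc⟩, if_neg (fun h => hc h.2), if_pos ⟨hx, hm⟩, add_zero]
          · rw [if_neg (fun h => hm h.2.1), if_neg (fun h => hc h.2), if_neg (fun h => hm h.2), add_zero]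
      · rw [if_neg (fun h => hx h.1), if_neg (fun h => hx h.1), if_neg (fun h => hx h.1), add_zero]
    -- the three private-dimension bounds, in `ℤ`
    have bI : ∀ i ∈ A, ((EI i).rank : ℤ) ≤
        ((Matrix.of fun x y => if (rI x ∈ A.erase i ∧ rJ x ∈ A') ∧ (cI y ∉ A.erase i ∧ cJ y ∉ A') then D x y else 0).rank : ℤ) -
        ((Matrix.of fun x y => if (rI x ∈ A.erase i ∧ rJ x ∈ A') ∧ (cI y ∉ A ∧ cJ y ∉ A') then D x y else 0).rank : ℤ) := by
      intro i hi
      have h := rkI i hi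
      rw [eI i hi] at h
      zify at h
      linarith
    have bJ : ∀ j ∈ A', ((EJ j).rank : ℤ) ≤
        ((Matrix.of fun x y => if (rI x ∈ A ∧ rJ x ∈ A'.erase j) ∧ (cI y ∉ A ∧ cJ y ∉ A'.erase j) then D x y else 0).rank : ℤ) -
        ((Matrix.of fun x y => if (rI x ∈ A ∧ rJ x ∈ A'.erase j) ∧ (cI y ∉ A ∧ cJ y ∉ A') then D x y else 0).rank : ℤ) := by
      intro j hj
      have h := rkJ j hj
      rw [eJ j hj] at h
      zify at h
      linarith
    have bC : ∀ i ∈ A, ∀ j ∈ A', ((EC i j).rank : ℤ) ≤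
        ((Matrix.of fun x y => if (rI x ∈ A.erase i ∧ rJ x ∈ A'.erase j) ∧ (cI y ∉ A.erase i ∧ cJ y ∉ A'.erase j)
            then D x y else 0).rank : ℤ) -
        ((Matrix.of fun x y => if (rI x ∈ A.erase i ∧ rJ x ∈ A'.erase j) ∧ (cI y ∉ A.erase i ∧ cJ y ∉ A'.erase j) ∧
            ¬ (cI y = i ∧ cJ y = j) then D x y else 0).rank : ℤ) := by
      intro i hi j hj
      have h := rkC i hi j hj
      rw [eC i j] at h
      zify at h
      linarith
    have hfin' : (L.rank : ℤ) ≤ (Qm.rank : ℤ) + ∑ i ∈ A, ((EI i).rank : ℤ) + ∑ j ∈ A', ((EJ j).rank : ℤ) +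
        ∑ i ∈ A, ∑ j ∈ A', ((EC i j).rank : ℤ) := by exact_mod_cast hfin
    have sI := Finset.sum_le_sum bI
    have sJ := Finset.sum_le_sum bJ
    have sC := Finset.sum_le_sum fun i hi => Finset.sum_le_sum (bC i hi)
    linarith

end Main

end Summit.PneNP.PneNP.Theorems.CnfIdealGenLengthRankDefectRepresentationsBandCompletion
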